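import Summits.RiemannHypothesis.RiemannHypothesis.Theorems.HandoffEvenRealZerosGrowth
import Literature.Analysis.Complex.VitaliConvergence
import Literature.Analysis.Complex.Hurwitz
import Literature.NumberTheory.LFunctions.RiemannXiProofs
import Literature.NumberTheory.LFunctions.ZetaRealAxis
import Summits.RiemannHypothesis.RiemannHypothesis.Theorems.SoloInformedGroundStateLimit
import HarnessLib

/-!
# Thin ⟹ full: Laguerre–Pólya rigidity of even real-rooted approximants of `Ξ` (file XVIII-b)

Handoff track (ROUTE 1′), seat handoff-theory-1 gen16 (H-T, statement owner; custody placement of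
idea-3 gen22's ROUTE R-K «COUNT ∧ THIN ⟹ RH», HOME/handoff/IDEAS-finite-rank.md v3.3.1 PART G22,
§G22-3/§G22-4; companion of prove-1 gen13's `HandoffRealZeroCount` / `HandoffXiZeroCount` /
`HandoffCountThin` (G22-T) and of `SoloInformedGroundStateLimit.riemannHypothesis_of_
tendstoLocallyUniformlyOn` (Hurwitz assembly on the STRIP); continuation of file XVIII-a
`HandoffEvenRealZerosGrowth`). Pure complex analysis, RH-free until §3; no definitions.

THE POINT. In R-K the approximants `û_t` (cosine transforms of the simple, even Weil ground states)
are EVEN real entire functions of exponential type with ONLY REAL ZEROS (Connes–van Suijlekom,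
CMP 2025, Thm 6.1 = the tree's CLOSED item `WeilGroundState.GroundStateMellinRealZeros`,
stmt-RiemannHypothesis-1528, available at every window where the crux `GroundStateSimpleEven`,
stmt-1526, holds; for the finite sections: Connes–Consani–Moscovici, arXiv:2511.22755, Thm 5.10
(iii), printed p. 23). For such a family, uniform convergence to `Ξ` on ONE disc about `0` already
forces locally uniform convergence on all of `ℂ`, hence — by Hurwitz — that `Ξ` has only real zeros,
i.e. RH. So, modulo the RH-free crux `GroundStateSimpleEven`, the THIN-CONVERGENCE conjunct SC-3
of R-K is alone `≥ RH` and the COUNT conjunct SC-2 is idle; and the tree's crux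
`WeilGroundState.GroundStatesConvergeToXi` (stmt-1527: convergence on the whole open strip — cf.
CCM p. 27 «Establishing this convergence rigorously would amount to a proof of the Riemann
Hypothesis», §8 pp. 32–33) may be asked on one disc only. The (B)-split relocates the RH-content;
it does not reduce it.

PRINT. The Laguerre–Pólya theorem as printed (Nguyen–Vishnyakova, Eur. J. Math. 2024, Thm 1 (i),
after Pólya 1913 / Hirschman–Widder Ch. III / Levin Ch. VIII): «Let (Pₙ), Pₙ(0) = 1, be a sequence
of hyperbolic polynomials which converges uniformly on the disc |z| ≤ A, A > 0. Then this sequence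
converges locally uniformly in ℂ to an entire function from the L-P class»; and (ibid.) «for a real
entire function (not identically zero) of the order less than 2 the property of having only real
zeros is equivalent to belonging to the Laguerre–Pólya class». The version proved HERE (a family of
even L-P FUNCTIONS of order < 2 converging on one disc ⟹ locally uniformly on ℂ) is not the printed
one: the normalisation `Pₙ(0) = 1` is replaced by `f 0 ≠ 0` for the limit (for `Ξ`: `Ξ(0) = ξ(1/2)
≠ 0`), and the growth control comes from file XVIII-a's 2-jet bound instead of Hadamard's product.

## Contents (all proved; standard axioms)

* §1 `norm_le_exp_sq_of_even_realZeros` — the bound of XVIII-a on all of `ℂ`: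
  `‖F z‖ ≤ ‖F 0‖ · exp(−Re(F″(0)/F(0))/2 · ‖z‖²)` (density of `Im z ≠ 0`).
* §2 `tendstoLocallyUniformlyOn_univ_of_even_realZeros` — THIN ⟹ FULL: such `F n` converging
  uniformly on `closedBall 0 A` to an entire `f` with `f 0 ≠ 0` have convergent 2-jets at `0`, hence
  are locally bounded on `ℂ` (§1), hence converge locally uniformly on `ℂ` (Vitali,
  `Literature/Analysis/Complex/VitaliConvergence.lean`, + identity theorem).
* §3 `riemannHypothesis_of_even_realZeros_of_tendstoUniformlyOn` — `f = Ξ = riemannXiUpper`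
  (`Ξ(0) = ξ(1/2) ≠ 0`): by §2 the convergence is locally uniform on `ℂ`, a fortiori on the strip
  `|Im z| < 1/2`, and the tree's Hurwitz assembly `SoloInformedGroundStateLimit.riemannHypothesis_
  of_realZero_approximants` gives `RiemannHypothesis`; `…_real` along `t → ∞`;
  `tendstoUniformlyOn_closedBall_of_thinRect` (even symmetrisation `[0, T] × [−δ, δ] ⊇
  closedBall 0 δ`); `riemannHypothesis_of_thin` = SC-3's shape with scalars `c t ≠ 0` and NO
  count law. So `riemannHypothesis_of_weilGroundStates`'s (M2) «on the strip» may be asked on one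
  disc about `0`.

Nothing here bears on the truth of RH: the hypotheses (real-rooted even approximants converging to
`Ξ` near the axis) are conjectural; the theorems only PLACE them (≥ RH).

## References

* G. Pólya, Über Annäherung durch Polynome mit lauter reellen Wurzeln, Rend. Circ. Mat. Palermo 36
  (1913) 279–295.
* T. H. Nguyen, A. Vishnyakova, Hutchinson's intervals and entire functions from the
  Laguerre–Pólya class, Eur. J. Math. (2024), Thm 1 (i) and §1.1 [corpus: arXiv:2212.05692 p. 3].
* A. Connes, C. Consani, H. Moscovici, Zeta spectral triples, arXiv:2511.22755, Thm 5.10 (p. 23),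
  §7 (p. 27), §8 (pp. 32–33).
* A. Connes, W. D. van Suijlekom, Commun. Math. Phys. (2025), Thm 6.1 (as vendored in the tree).
-/

set_option linter.dupNamespace false

noncomputable section

open Filter Set Topology Metric Complex
open scoped ComplexConjugate Real

namespace Summit.RiemannHypothesis.RiemannHypothesis.Theorems

namespace ThinRigidity

open Literature.Analysis.Complex

/-! ## §1 (continued) The growth bound on all of `ℂ` -/

section Growth

variable {F : ℂ → ℂ}

/-- **Growth from the 2-jet (Laguerre–Pólya).** An even entire function of order `< 2` with only
real zeros and `F 0 ≠ 0` satisfies `‖F z‖ ≤ ‖F 0‖ · exp(−Re(F″(0)/F(0))/2 · ‖z‖²)` for every `z`.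
(Classically: `F(z) = F(0) ∏ (1 − z²/aₖ²)` and `Σ 1/aₖ² = −F″(0)/(2F(0))`; here product-free.) -/
theorem norm_le_exp_sq_of_even_realZeros (hF : Differentiable ℂ F) {ρ C : ℝ} (hρ0 : 0 ≤ ρ)
    (hρ : ρ < 2) (hgr : ∀ z, ‖F z‖ ≤ C * Real.exp (‖z‖ ^ ρ)) (heven : ∀ z, F (-z) = F z)
    (hzero : ∀ z, F z = 0 → z.im = 0) (h0 : F 0 ≠ 0) (z : ℂ) :
    ‖F z‖ ≤ ‖F 0‖ * Real.exp (-(deriv (deriv F) 0 / F 0).re / 2 * ‖z‖ ^ 2) := by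
  set L : ℝ := -(deriv (deriv F) 0 / F 0).re with hL
  -- off the real axis
  have hoff : ∀ w : ℂ, w.im ≠ 0 → ‖F w‖ ≤ ‖F 0‖ * Real.exp (L / 2 * ‖w‖ ^ 2) := by
    intro w hw
    have h := log_norm_sub_le_of_im_ne_zero hF hρ0 hρ hgr heven hzero h0 hw
    rw [deriv_logDeriv_zero_of_even hF heven h0] at h
    have hFw : F w ≠ 0 := fun h' => hw (hzero w h')
    have hpos : 0 < ‖F w‖ := norm_pos_iff.2 hFw
    have hpos0 : 0 < ‖F 0‖ := norm_pos_iff.2 h0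
    calc ‖F w‖ = Real.exp (Real.log ‖F w‖) := (Real.exp_log hpos).symm
      _ ≤ Real.exp (Real.log ‖F 0‖ + L / 2 * ‖w‖ ^ 2) := Real.exp_le_exp.2 (by rw [hL]; linarith)
      _ = ‖F 0‖ * Real.exp (L / 2 * ‖w‖ ^ 2) := by rw [Real.exp_add, Real.exp_log hpos0]
  have hgoal : ∀ w : ℂ, ‖F 0‖ * Real.exp (L / 2 * ‖w‖ ^ 2) =
      ‖F 0‖ * Real.exp (-(deriv (deriv F) 0 / F 0).re / 2 * ‖w‖ ^ 2) := fun w => by rw [hL]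
  rw [← hgoal]
  by_cases hz : z.im ≠ 0
  · exact hoff z hz
  push Not at hz
  -- on the real axis: approach `z` vertically
  set r : ℕ → ℝ := fun n => 1 / ((n : ℝ) + 1) with hr
  have hr_lim : Tendsto r atTop (𝓝 0) := tendsto_one_div_add_atTop_nhds_zero_nat
  have hr_pos : ∀ n, 0 < r n := fun n => by rw [hr]; positivity
  set zs : ℕ → ℂ := fun n => z + (r n : ℂ) * I with hzs
  have hzs_im : ∀ n, (zs n).im ≠ 0 := by
    intro n
    have : (zs n).im = r n := by simp [hzs, hz]
    rw [this]; exact (hr_pos n).ne'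
  have hzs_lim : Tendsto zs atTop (𝓝 z) := by
    have h1 : Tendsto (fun n : ℕ => ((r n : ℝ) : ℂ)) atTop (𝓝 0) := by
      have := (Complex.continuous_ofReal.tendsto 0).comp hr_lim
      rwa [Complex.ofReal_zero] at this
    have h2 := (h1.mul_const I).const_add z
    simpa [hzs] using h2
  have hf1 : Tendsto (fun n => ‖F (zs n)‖) atTop (𝓝 ‖F z‖) :=
    ((hF.continuous.tendsto z).comp hzs_lim).norm
  have hcont : Continuous fun w : ℂ => ‖F 0‖ * Real.exp (L / 2 * ‖w‖ ^ 2) := by fun_prop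
  have hf2 : Tendsto (fun n => ‖F 0‖ * Real.exp (L / 2 * ‖zs n‖ ^ 2)) atTop
      (𝓝 (‖F 0‖ * Real.exp (L / 2 * ‖z‖ ^ 2))) := (hcont.tendsto z).comp hzs_lim
  exact le_of_tendsto_of_tendsto' hf1 hf2 fun n => hoff (zs n) (hzs_im n)

end Growth

/-! ## §2 Thin ⟹ full: locally uniform convergence on `ℂ` from convergence on one disc -/

section Family

/-- The hypotheses on the approximating family: each `F n` is entire, of order `< 2`, even, and has
only real zeros. (A predicate-free bundle, spelled out in each statement.) -/
theorem differentiable_deriv_of_differentiable {F : ℂ → ℂ} (hF : Differentiable ℂ F) :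
    Differentiable ℂ (deriv F) := fun w =>
  ((hF.differentiableOn.analyticOnNhd isOpen_univ).deriv w (mem_univ w)).differentiableAt

/-- **Thin ⟹ full (Laguerre–Pólya rigidity).** Let `F n` be entire, of order `< 2`, even, with
only real zeros, and suppose `F n → f` uniformly on a closed disc `closedBall 0 A` (`A > 0`), where
`f` is entire with `f 0 ≠ 0`. Then `F n → f` locally uniformly on all of `ℂ`. -/
theorem tendstoLocallyUniformlyOn_univ_of_even_realZeros {F : ℕ → ℂ → ℂ} {f : ℂ → ℂ}
    (hF : ∀ n, Differentiable ℂ (F n))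
    (hgr : ∀ n, ∃ ρ C : ℝ, 0 ≤ ρ ∧ ρ < 2 ∧ ∀ z, ‖F n z‖ ≤ C * Real.exp (‖z‖ ^ ρ))
    (heven : ∀ n z, F n (-z) = F n z) (hzero : ∀ n z, F n z = 0 → z.im = 0)
    (hf : Differentiable ℂ f) (hf0 : f 0 ≠ 0) {A : ℝ} (hA : 0 < A)
    (hlim : TendstoUniformlyOn F f atTop (closedBall 0 A)) :
    TendstoLocallyUniformlyOn F f atTop univ := by
  classical
  have h0mem : (0 : ℂ) ∈ ball (0 : ℂ) A := mem_ball_self hA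
  have hlimB : TendstoLocallyUniformlyOn F f atTop (ball 0 A) :=
    (hlim.mono ball_subset_closedBall).tendstoLocallyUniformlyOn
  -- convergence of the 2-jets at `0`
  have hd1 : TendstoLocallyUniformlyOn (deriv ∘ F) (deriv f) atTop (ball 0 A) :=
    hlimB.deriv (Eventually.of_forall fun n => (hF n).differentiableOn) isOpen_ball
  have hd2 : TendstoLocallyUniformlyOn (deriv ∘ (deriv ∘ F)) (deriv (deriv f)) atTop (ball 0 A) :=
    hd1.deriv (Eventually.of_forall fun n =>
      (differentiable_deriv_of_differentiable (hF n)).differentiableOn) isOpen_ball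
  have t0 : Tendsto (fun n => F n 0) atTop (𝓝 (f 0)) := hlimB.tendsto_at h0mem
  have t2 : Tendsto (fun n => deriv (deriv (F n)) 0) atTop (𝓝 (deriv (deriv f) 0)) :=
    hd2.tendsto_at h0mem
  set L : ℕ → ℝ := fun n => -(deriv (deriv (F n)) 0 / F n 0).re with hL
  set Lf : ℝ := -(deriv (deriv f) 0 / f 0).re with hLf
  have tL : Tendsto L atTop (𝓝 Lf) := by
    have := ((Complex.continuous_re.tendsto _).comp (t2.div t0 hf0)).neg
    simpa [hL, hLf] using this
  -- eventual control of `‖F n 0‖` and `L n`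
  have e1 : ∀ᶠ n in atTop, ‖F n 0‖ < ‖f 0‖ + 1 := (tendsto_order.1 t0.norm).2 _ (lt_add_one _)
  have e2 : ∀ᶠ n in atTop, L n < Lf + 1 := (tendsto_order.1 tL).2 _ (lt_add_one _)
  have e3 : ∀ᶠ n in atTop, F n 0 ≠ 0 := t0.eventually_ne hf0
  obtain ⟨N, hN⟩ := eventually_atTop.1 (e1.and (e2.and e3))
  -- bounds for the finitely many initial terms on a given ball
  have hb : ∀ a ∈ (univ : Set ℂ), ∃ M : ℝ, ∃ r > 0, ∀ n, ∀ z ∈ ball a r ∩ univ, ‖F n z‖ ≤ M := by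
    intro a _
    have hcpt : IsCompact (closedBall a 1) := isCompact_closedBall a 1
    have hbd : ∀ n, ∃ Cn : ℝ, ∀ z ∈ closedBall a 1, ‖F n z‖ ≤ Cn := fun n =>
      hcpt.exists_bound_of_continuousOn (hF n).continuous.continuousOn
    choose Cn hCn using hbd
    set Mtail : ℝ := (‖f 0‖ + 1) * Real.exp ((|Lf| + 1) / 2 * (‖a‖ + 1) ^ 2) with hMtail
    have hMtail0 : 0 ≤ Mtail := by positivity
    refine ⟨Mtail + ∑ n ∈ Finset.range N, |Cn n|, 1, one_pos, fun n z hz => ?_⟩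
    have hz1 : z ∈ closedBall a 1 := ball_subset_closedBall hz.1
    have hsum0 : 0 ≤ ∑ n ∈ Finset.range N, |Cn n| := Finset.sum_nonneg fun _ _ => abs_nonneg _
    rcases lt_or_ge n N with hn | hn
    · calc ‖F n z‖ ≤ Cn n := hCn n z hz1
        _ ≤ |Cn n| := le_abs_self _
        _ ≤ ∑ k ∈ Finset.range N, |Cn k| :=
            Finset.single_le_sum (f := fun k => |Cn k|) (fun _ _ => abs_nonneg _)
              (Finset.mem_range.2 hn)
        _ ≤ Mtail + ∑ k ∈ Finset.range N, |Cn k| := by linarith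
    · obtain ⟨h1, h2, h3⟩ := hN n hn
      obtain ⟨ρ, C, hρ0, hρ, hgrn⟩ := hgr n
      have hgrow := norm_le_exp_sq_of_even_realZeros (hF n) hρ0 hρ hgrn (heven n) (hzero n) h3 z
      have hza : ‖z‖ ≤ ‖a‖ + 1 := by
        have : ‖z - a‖ ≤ 1 := mem_closedBall_iff_norm.1 hz1
        calc ‖z‖ = ‖(z - a) + a‖ := by ring_nf
          _ ≤ ‖z - a‖ + ‖a‖ := norm_add_le _ _
          _ ≤ ‖a‖ + 1 := by linarith
      have hexp : -(deriv (deriv (F n)) 0 / F n 0).re / 2 * ‖z‖ ^ 2 ≤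
          (|Lf| + 1) / 2 * (‖a‖ + 1) ^ 2 := by
        have hLn : -(deriv (deriv (F n)) 0 / F n 0).re = L n := by rw [hL]
        rw [hLn]
        have hLle : L n ≤ |Lf| + 1 := by linarith [le_abs_self Lf]
        have hz2 : ‖z‖ ^ 2 ≤ (‖a‖ + 1) ^ 2 := by
          exact pow_le_pow_left₀ (norm_nonneg _) hza 2
        rcases le_or_gt 0 (L n) with hL0 | hL0
        · calc L n / 2 * ‖z‖ ^ 2 ≤ (|Lf| + 1) / 2 * ‖z‖ ^ 2 := by gcongr
            _ ≤ (|Lf| + 1) / 2 * (‖a‖ + 1) ^ 2 := by gcongr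
        · calc L n / 2 * ‖z‖ ^ 2 ≤ 0 := by
                have : 0 ≤ ‖z‖ ^ 2 := by positivity
                nlinarith
            _ ≤ (|Lf| + 1) / 2 * (‖a‖ + 1) ^ 2 := by positivity
      calc ‖F n z‖ ≤ ‖F n 0‖ * Real.exp (-(deriv (deriv (F n)) 0 / F n 0).re / 2 * ‖z‖ ^ 2) := hgrow
        _ ≤ (‖f 0‖ + 1) * Real.exp ((|Lf| + 1) / 2 * (‖a‖ + 1) ^ 2) := by
            gcongr
        _ = Mtail := by rw [hMtail]
        _ ≤ Mtail + ∑ k ∈ Finset.range N, |Cn k| := by linarith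
  -- pointwise convergence near `0`
  have hS : ∃ᶠ z in 𝓝[≠] (0 : ℂ), ∃ c : ℂ, Tendsto (fun n => F n z) atTop (𝓝 c) := by
    have hev : ∀ᶠ z in 𝓝[≠] (0 : ℂ), ∃ c : ℂ, Tendsto (fun n => F n z) atTop (𝓝 c) := by
      have : ball (0 : ℂ) A ∈ 𝓝[≠] (0 : ℂ) :=
        mem_nhdsWithin_of_mem_nhds (isOpen_ball.mem_nhds h0mem)
      filter_upwards [this] with z hz using ⟨f z, hlimB.tendsto_at hz⟩
    exact hev.frequently
  -- Vitali
  obtain ⟨g, hg, hFg⟩ := exists_tendstoLocallyUniformlyOn_of_frequently_tendsto isOpen_univ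
    isPreconnected_univ (fun n => (hF n).differentiableOn) hb (mem_univ 0) hS
  -- `g = f`
  have hgf : EqOn g f (ball 0 A) := fun z hz =>
    tendsto_nhds_unique (hFg.tendsto_at (mem_univ z)) (hlimB.tendsto_at hz)
  have hgA : AnalyticOnNhd ℂ g univ := hg.analyticOnNhd isOpen_univ
  have hfA : AnalyticOnNhd ℂ f univ := hf.differentiableOn.analyticOnNhd isOpen_univ
  have hgf' : EqOn g f univ := by
    have hev : g =ᶠ[𝓝 (0 : ℂ)] f :=
      Filter.eventuallyEq_of_mem (isOpen_ball.mem_nhds h0mem) hgf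
    exact hgA.eqOn_of_preconnected_of_eventuallyEq hfA isPreconnected_univ (mem_univ 0) hev
  exact hFg.congr_right hgf'

end Family

/-! ## §3 The Riemann Hypothesis from real-rooted even approximants of `Ξ` converging on a disc -/

section Xi

open Literature.NumberTheory.LFunctions

/-- `Ξ(0) = ξ(1/2) ≠ 0` (no zero of `ζ` on the real segment `(0, 1)`). -/
theorem riemannXiUpper_zero_ne_zero : riemannXiUpper 0 ≠ 0 := by
  intro h
  have h' : riemannXi (1 / 2 + I * 0) = 0 := h
  rw [mul_zero, add_zero] at h'
  obtain ⟨hζ, h0, h1⟩ := (riemannXi_eq_zero_iff_holds _).1 h'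
  exact riemannZeta_ne_zero_of_im_eq_zero_of_pos_of_lt_one (by simp) h0 h1 hζ

/-- **RH from thin convergence of even real-rooted approximants.** If entire functions `F n` of
order `< 2`, even, with only real zeros, converge to `Ξ` uniformly on some disc `closedBall 0 A`
(`A > 0`), then every zero of `Ξ` is real, i.e. the Riemann Hypothesis holds. (Modulo the RH-free
crux `GroundStateSimpleEven`, this is the placement of route R-K's conjunct SC-3 alone: `≥ RH`.)
Nothing here bears on the truth of RH: the hypothesis is conjectural. -/
theorem riemannHypothesis_of_even_realZeros_of_tendstoUniformlyOn {F : ℕ → ℂ → ℂ}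
    (hF : ∀ n, Differentiable ℂ (F n))
    (hgr : ∀ n, ∃ ρ C : ℝ, 0 ≤ ρ ∧ ρ < 2 ∧ ∀ z, ‖F n z‖ ≤ C * Real.exp (‖z‖ ^ ρ))
    (heven : ∀ n z, F n (-z) = F n z) (hzero : ∀ n z, F n z = 0 → z.im = 0)
    {A : ℝ} (hA : 0 < A) (hlim : TendstoUniformlyOn F riemannXiUpper atTop (closedBall 0 A)) :
    RiemannHypothesis := by
  have hfull := tendstoLocallyUniformlyOn_univ_of_even_realZeros hF hgr heven hzero
    differentiable_riemannXiUpper' riemannXiUpper_zero_ne_zero hA hlim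
  -- Hurwitz on the strip `|Im z| < 1/2` (`SoloInformedGroundStateLimit`), a fortiori from `univ`
  exact riemannHypothesis_of_realZero_approximants F hF hzero (hfull.mono (subset_univ _))

/-- The same along a real parameter `t → ∞` (the form of idea-3's SC-3 / prove-1's
`ThinConvergence`, whose thin rectangles `[0, T] × [−δ, δ]` contain a disc about `0` after the
even symmetrisation `z ↦ −z`). -/
theorem riemannHypothesis_of_even_realZeros_of_tendstoUniformlyOn_real {F : ℝ → ℂ → ℂ}
    (hF : ∀ t, Differentiable ℂ (F t))
    (hgr : ∀ t, ∃ ρ C : ℝ, 0 ≤ ρ ∧ ρ < 2 ∧ ∀ z, ‖F t z‖ ≤ C * Real.exp (‖z‖ ^ ρ))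
    (heven : ∀ t z, F t (-z) = F t z) (hzero : ∀ t z, F t z = 0 → z.im = 0)
    {A : ℝ} (hA : 0 < A) (hlim : TendstoUniformlyOn F riemannXiUpper atTop (closedBall 0 A)) :
    RiemannHypothesis := by
  have hlim' : TendstoUniformlyOn (fun n : ℕ => F n) riemannXiUpper atTop (closedBall 0 A) :=
    fun u hu => tendsto_natCast_atTop_atTop.eventually (hlim u hu)
  exact riemannHypothesis_of_even_realZeros_of_tendstoUniformlyOn (fun n => hF n) (fun n => hgr n)
    (fun n => heven n) (fun n => hzero n) hA hlim'

/-- From a thin rectangle to a disc: for EVEN `Φ n` and the even `Ξ`, uniform convergence on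
`[0, T] × [−δ, δ]` (`0 < δ ≤ T`) gives uniform convergence on `closedBall 0 δ`. -/
theorem tendstoUniformlyOn_closedBall_of_thinRect {ι : Type*} {p : Filter ι} {Φ : ι → ℂ → ℂ}
    (heven : ∀ n z, Φ n (-z) = Φ n z) {T δ : ℝ} (hδT : δ ≤ T)
    (h : TendstoUniformlyOn Φ riemannXiUpper p (Icc 0 T ×ℂ Icc (-δ) δ)) :
    TendstoUniformlyOn Φ riemannXiUpper p (closedBall 0 δ) := by
  intro u hu
  filter_upwards [h u hu] with n hn z hz
  have hzn : ‖z‖ ≤ δ := mem_closedBall_zero_iff.1 hz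
  have hre : |z.re| ≤ δ := (Complex.abs_re_le_norm z).trans hzn
  have him : |z.im| ≤ δ := (Complex.abs_im_le_norm z).trans hzn
  rcases le_or_gt 0 z.re with h0 | h0
  · exact hn z (mem_reProdIm.2 ⟨⟨h0, (le_abs_self _).trans (hre.trans hδT)⟩, abs_le.1 him⟩)
  · have hneg : -z ∈ Icc 0 T ×ℂ Icc (-δ) δ := by
      refine mem_reProdIm.2 ⟨⟨?_, ?_⟩, ?_⟩
      · simp; exact h0.le
      · simp; linarith [neg_le_abs z.re, hre]
      · simpa [abs_le, neg_le, and_comm] using him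
    have := hn (-z) hneg
    rwa [riemannXiUpper_neg, heven] at this

/-- **Route R-K placed (idea-3 gen22, §G22-3): SC-3 alone, for real-rooted even approximants.**
If `û_t` (entire, of order `< 2`, even, only real zeros — e.g. the cosine transforms of simple
even Weil ground states, by `WeilGroundState.GroundStateMellinRealZeros`) satisfy, for some
`δ > 0`, `T ≥ δ` and scalars `c_t ≠ 0`, `c_t û_t → Ξ` uniformly on the thin rectangle
`[0, T] × [−δ, δ]` as `t → ∞`, then RH. No count law is used. -/
theorem riemannHypothesis_of_thin {F : ℝ → ℂ → ℂ} (c : ℝ → ℂ) (hc : ∀ t, c t ≠ 0)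
    (hF : ∀ t, Differentiable ℂ (F t))
    (hgr : ∀ t, ∃ ρ C : ℝ, 0 ≤ ρ ∧ ρ < 2 ∧ ∀ z, ‖F t z‖ ≤ C * Real.exp (‖z‖ ^ ρ))
    (heven : ∀ t z, F t (-z) = F t z) (hzero : ∀ t z, F t z = 0 → z.im = 0)
    {T δ : ℝ} (hδ : 0 < δ) (hδT : δ ≤ T)
    (hlim : TendstoUniformlyOn (fun t z => c t * F t z) riemannXiUpper atTop
      (Icc 0 T ×ℂ Icc (-δ) δ)) :
    RiemannHypothesis := by
  have heven' : ∀ t z, c t * F t (-z) = c t * F t z := fun t z => by rw [heven]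
  have hdisc := tendstoUniformlyOn_closedBall_of_thinRect (Φ := fun t z => c t * F t z) heven' hδT hlim
  refine riemannHypothesis_of_even_realZeros_of_tendstoUniformlyOn_real (F := fun t z => c t * F t z)
    (fun t => (differentiable_const _).mul (hF t)) (fun t => ?_) heven' (fun t z h => ?_) hδ hdisc
  · obtain ⟨ρ, C, hρ0, hρ, h⟩ := hgr t
    refine ⟨ρ, ‖c t‖ * C, hρ0, hρ, fun z => ?_⟩
    rw [norm_mul, mul_assoc]
    exact mul_le_mul_of_nonneg_left (h z) (norm_nonneg _)
  · rcases mul_eq_zero.1 h with h' | h'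
    · exact absurd h' (hc t)
    · exact hzero t z h'

end Xi

end ThinRigidity

end Summit.RiemannHypothesis.RiemannHypothesis.Theorems
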